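import Summits.ResolutionOfSingularities.ResolutionOfSingularities.Theses.FrobeniusLadder
import Summits.ResolutionOfSingularities.ResolutionOfSingularities.Theorems.FrobeniusLadderFRationalResolutionRungsIff
import Summits.ResolutionOfSingularities.ResolutionOfSingularities.Theorems.FrobeniusLadderFRationalResolutionGorensteinSector
import Summits.ResolutionOfSingularities.ResolutionOfSingularities.Theorems.FrobeniusLadderFRationalResolutionStubComponents
import Summits.ResolutionOfSingularities.ResolutionOfSingularities.Theorems.FrobeniusLadderFRationalResolutionStubClauseOfRingEquiv
import Literature.AlgebraicGeometry.Resolution.QuasiProjectiveResolution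
import Literature.AlgebraicGeometry.Resolution.TameQuotientSingularitiesResolution
import Mathlib.RingTheory.RegularLocalRing.Defs
import Mathlib.AlgebraicGeometry.Noetherian
import Summits.ResolutionOfSingularities.ResolutionOfSingularities.Theorems.FrobeniusLadderFRationalResolutionTowerStep
import Summits.ResolutionOfSingularities.ResolutionOfSingularities.Theorems.FrobeniusLadderFRationalResolutionToricBaseRegular
import Summits.ResolutionOfSingularities.ResolutionOfSingularities.Theorems.FrobeniusLadderFRationalResolutionToricXChartRegular
import Summits.ResolutionOfSingularities.ResolutionOfSingularities.Theorems.FrobeniusLadderFRationalResolutionToricTorusLocalization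
import Summits.ResolutionOfSingularities.ResolutionOfSingularities.Theorems.FrobeniusLadderFRationalResolutionToricTheta
import Summits.ResolutionOfSingularities.ResolutionOfSingularities.Theorems.FrobeniusLadderFRationalResolutionToricYChartCarrier
import Summits.ResolutionOfSingularities.ResolutionOfSingularities.Theorems.FrobeniusLadderFRationalResolutionToricIsoAwayW
import Summits.ResolutionOfSingularities.ResolutionOfSingularities.Theorems.FrobeniusLadderFRationalResolutionToricFiniteType
import Summits.ResolutionOfSingularities.ResolutionOfSingularities.Theorems.FrobeniusLadderFRationalResolutionToricVertexUnique
import Summits.ResolutionOfSingularities.ResolutionOfSingularities.Theorems.FrobeniusLadderFRationalResolutionToricLocallyOfFiniteType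
import Summits.ResolutionOfSingularities.ResolutionOfSingularities.Theorems.FrobeniusLadderFRationalResolutionToricRetract
import Summits.ResolutionOfSingularities.ResolutionOfSingularities.Theorems.FrobeniusLadderFRationalResolutionRetractLocalization
import Summits.ResolutionOfSingularities.ResolutionOfSingularities.Theorems.FrobeniusLadderFRationalResolutionRegularRingLocalization
import Summits.ResolutionOfSingularities.ResolutionOfSingularities.Theorems.FrobeniusLadderFRationalResolutionClauseOfRetractRegular
import Summits.ResolutionOfSingularities.ResolutionOfSingularities.Theorems.FrobeniusLadderFRationalResolutionToricResolution
import Summits.ResolutionOfSingularities.ResolutionOfSingularities.Theorems.FrobeniusLadderFRationalResolutionToricDimension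
import Summits.ResolutionOfSingularities.ResolutionOfSingularities.Theorems.FrobeniusLadderFRationalResolutionToricVertexSingular
import Summits.ResolutionOfSingularities.ResolutionOfSingularities.Theorems.FrobeniusLadderFRationalResolutionToricWeightZero
import Summits.ResolutionOfSingularities.ResolutionOfSingularities.Theorems.FrobeniusLadderFRationalResolutionToricReduceMod
import Summits.ResolutionOfSingularities.ResolutionOfSingularities.Theorems.FrobeniusLadderFRationalResolutionToricDegenerateRegular
import Summits.ResolutionOfSingularities.ResolutionOfSingularities.Theorems.FrobeniusLadderFRationalResolutionToricClass
import Summits.ResolutionOfSingularities.ResolutionOfSingularities.Theorems.FrobeniusLadderFRationalResolutionToricStalks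
import Mathlib.RingTheory.MvPolynomial.WeightedHomogeneous
import Mathlib.Algebra.MonoidAlgebra.Basic
import Mathlib.RingTheory.FiniteType
import Mathlib.RingTheory.RegularLocalRing.Polynomial
import Mathlib.Algebra.Order.Antidiag.Finsupp
import Literature.AlgebraicGeometry.Resolution.AffineBlowupRegular
import HarnessLib

/-!
# Skeleton `redirect` for crux stmt-ResolutionOfSingularities-15317 `FrobeniusLadder.FRationalResolution`
(crux-strategist planner-cstrat-stmt-ResolutionOfSingularities-15317-r1-0, 2026-08-17)

The BC2-REDIRECT decomposition of the crux, ONE LAYER DOWN and fully typed: the crux (resolution of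
reduced separated finite-type `X/k`, `char k = p`, admitting an F-rational proper birational model) is
EQUIVALENT (tree: `fRationalResolution_iff_rungs`, p129251) to the conjunction of

* `X₁ = WeaklyFRegularModification` (rung 3½, F-REGULARIZATION): integral F-rational `X/k` ⇒ proper
  birational model with weakly F-regular stalks (domain, EVERY ideal tightly closed);
* `X₂ = WeaklyFRegularResolution` (rung 4′): weakly F-regular `X/k` ⇒ `Scheme.HasResolution X`;

(both defined below VERBATIM as they are to be filed as route items by
`route edit --split FRationalResolution --into children.json`; kept in this file's namespace so that
nothing clashes with the route decls once the split is written), and each piece gets its own plan: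

X₁ (engine = card `test-ideal-rung-to-f-regular`: Kawasaki/Česnavičius induction on the
non-weakly-F-regular locus `V(τ)` with the test ideal as uniform annihilator and centre; the Gorenstein
sector is already weakly F-regular by Hochster–Huneke 1994 Thm 4.2, LANDED as
`weaklyFRegular_of_fRational_of_socle_cyclic`):
* `stub_gorensteinSector` — PROVED here from the landed ring-level theorem;
* `stub_spreadOut` (OPEN) — integral F-rational `X` ⇒ integral F-rational model whose stalks, off a
  FINITE set, are weakly F-regular or Gorenstein;
* `stub_isolatedFRegularization` (OPEN; dim 2 = Lipman 1969 + Hara 1998) — finitely many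
  non-weakly-F-regular points ⇒ weakly F-regular model.

X₂ ("lrq-ification + tame endgame", card §(4): CST arXiv:1606.04088, Carvajal-Rojas arXiv:1710.06887,
LMM arXiv:2102.01067 Thm 1.6, Bergh–Rydh arXiv:1905.00872 Thm 5):
* `stub_quotientModel` (OPEN, the hard half) — integral weakly F-regular `X` ⇒ proper birational
  integral model with diagonalizable-quotient singularities presented by étale charts from
  `Spec S₀`, `S` REGULAR finitely generated graded by a finite abelian group;
* `stub_diagonalizableQuotientResolution` (printed for perfect `k` = tree fact
  `BerghRydh2019_diagonalizableQuotientResolution`; all-fields/regular-chart form is the stub's risk)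
  — such `X` are resolvable.

Compositions (all PROVED, no sorry outside `stub_*`): `WeaklyFRegularModification_of`,
`WeaklyFRegularResolution_of` (components + clause transport + `of_isBirational`), and the crux BY NAME
`FRationalResolution_of := fRationalResolution_iff_rungs.mpr ⟨X₁_of, X₂_of⟩`.

Relation to line `Sketch` (lead c3, untouched): `Sketch` holds 3½/4′ as two opaque research stubs;
`redirect` cuts each once more (4 open stubs, 2 per rung) and makes HH94 load-bearing glue. Disproof.lean
v2 honoured: `LocallyOfFiniteType` kept in every stub; every open stub is summit-implied (take a
resolution), so none is an instance a landed Negative lemma refutes.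

LEAD c4 (2026-08-17): skeleton of record copied from `Lines/redirect.lean`; the four redirect stubs are untouched
(research-sized, summit-implied). Appended below the crux composition: the TORIC SURFACE PROGRAMME (section
`Toric`) — rung 4′ = X₂'s endgame `stub_diagonalizableQuotientResolution` in its dimension-2, Zariski-chart,
ALL-FIELDS instance: every affine toric surface `U(r,a) = Spec k[{m ∈ ℤ² : 0 ≤ m₂, a m₂ ≤ r m₁}]` (all cyclic
quotient surface singularities, every field) is resolved by the Hirzebruch–Jung tower of two-chart monomial
blow-ups `Bl_{(x,xy)} U(r,a) = 𝔸² ∪ U(a, ⌈r/a⌉a − r)`, glued by the abstract `towerStep`; its worker stubs are the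
`stub_toric_*` below, the lead's theorems are `toric_*` / `hasResolution_toricSurface`.

LEAD c5 (2026-08-17): the four redirect stubs untouched; appended the CONE PROGRAMME (section `Cones`) — rung 4′ in
ALL DIMENSIONS on the Veronese cones `V(n,r) = 𝔸ⁿ/μ_r (weights 1,…,1)`, every field: one blow-up of the vertex,
`n` affine-space charts, generic sub-cover criterion; worker stubs `stub_veronese_*`, `stub_finsupp_degree_split`,
`stub_affineBlowup_cover_of_pow`; lead theorems `hasResolution_of_regular_charts`, `hasResolution_veroneseCone`.
-/

set_option linter.dupNamespace false

noncomputable section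

open CategoryTheory AlgebraicGeometry TopologicalSpace
open Literature.AlgebraicGeometry.Resolution

namespace Summit.ResolutionOfSingularities.ResolutionOfSingularities.Cruxes.FRationalResolution.Redirect

/-! ## The two pieces (verbatim the item statements of `children.json`) -/

/-- PIECE X₁ (rung 3½) — F-REGULARIZATION OF F-RATIONAL VARIETIES: every integral separated
finite-type `X/k` (`char k = p`) with F-rational stalks has a proper birational model all of whose
stalks are domains with EVERY ideal tightly closed. (To be filed as route item
`Theses.FrobeniusLadder.WeaklyFRegularModification`.) -/
def WeaklyFRegularModification : Prop :=
  ∀ p : ℕ, p.Prime → ∀ (k : Type) [Field k] [CharP k p] (X : AlgebraicGeometry.Scheme.{0}) (f : X ⟶ AlgebraicGeometry.Spec (.of k)), AlgebraicGeometry.IsSeparated f → AlgebraicGeometry.LocallyOfFiniteType f → AlgebraicGeometry.QuasiCompact f → AlgebraicGeometry.IsIntegral X → (∀ x : X, IsDomain (X.presheaf.stalk x) ∧ ∀ d : ℕ, ringKrullDim (X.presheaf.stalk x) = d → ∀ s : Fin d → X.presheaf.stalk x, (Ideal.span (Set.range s)).radical.IsMaximal → ∀ y c : X.presheaf.stalk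 x, c ≠ 0 → (∀ e : ℕ, c * y ^ p ^ e ∈ Ideal.span ((fun z : X.presheaf.stalk x => z ^ p ^ e) '' (Ideal.span (Set.range s) : Set (X.presheaf.stalk x)))) → y ∈ Ideal.span (Set.range s)) → ∃ (X' : AlgebraicGeometry.Scheme.{0}) (π : X' ⟶ X), AlgebraicGeometry.IsProper π ∧ Literature.AlgebraicGeometry.Resolution.IsBirational π ∧ ∀ x : X', IsDomain (X'.presheaf.stalk x) ∧ ∀ I : Ideal (X'.presheaf.stalk x), ∀ y c : X'.presheaf.stalk x, c ≠ 0 → (∀ e : ℕ, c * y ^ p ^ e ∈ Ideal.span ((fun z : X'.presheaf.stalk x => z ^ p ^ e) '' (I : Set (X'.presheaf.stalk x)))) → y ∈ I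

/-- PIECE X₂ (rung 4′) — RESOLUTION OF WEAKLY F-REGULAR VARIETIES: every separated finite-type `X/k`
(`char k = p`) whose stalks are domains with every ideal tightly closed has a resolution of
singularities. (To be filed as route item `Theses.FrobeniusLadder.WeaklyFRegularResolution`.) -/
def WeaklyFRegularResolution : Prop :=
  ∀ p : ℕ, p.Prime → ∀ (k : Type) [Field k] [CharP k p] (X : AlgebraicGeometry.Scheme.{0}) (f : X ⟶ AlgebraicGeometry.Spec (.of k)), AlgebraicGeometry.IsSeparated f → AlgebraicGeometry.LocallyOfFiniteType f → AlgebraicGeometry.QuasiCompact f → (∀ x : X, IsDomain (X.presheaf.stalk x) ∧ ∀ I : Ideal (X.presheaf.stalk x), ∀ y c : X.presheaf.stalk x, c ≠ 0 → (∀ e : ℕ, c * y ^ p ^ e ∈ Ideal.span ((fun z : X.presheaf.stalk x => z ^ p ^ e) '' (I : Set (X.presheaf.stalk x)))) → y ∈ I) → Literature.AlgebraicGeometry.Resolution.Scheme.HasResolution X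

/-! ## X₁ · Stub 1 — the Gorenstein sector (Hochster–Huneke 1994, Thm 4.2), PROVED from the tree -/

/-- STUB (Gorenstein sector, scheme level; proved from the landed ring-level theorem
`weaklyFRegular_of_fRational_of_socle_cyclic`): a stalk of a `k`-scheme locally of finite type whose
parameter ideals are all tightly closed (the crux's inline F-rational clause) and all have CYCLIC SOCLE
(`(s) : 𝔪 = (s) + (t)`, i.e. the local ring is Gorenstein) has EVERY ideal tightly closed (the weakly
F-regular clause of the piece). -/
theorem stub_gorensteinSector (p : ℕ) (k : Type) [Field k] (X : Scheme.{0}) (f : X ⟶ Spec (.of k))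
    [LocallyOfFiniteType f] (x : X)
    (hFR : ∀ d : ℕ, ringKrullDim (X.presheaf.stalk x) = d → ∀ s : Fin d → X.presheaf.stalk x,
      (Ideal.span (Set.range s)).radical.IsMaximal → ∀ y c : X.presheaf.stalk x, c ≠ 0 →
      (∀ e : ℕ, c * y ^ p ^ e ∈ Ideal.span ((fun z : X.presheaf.stalk x => z ^ p ^ e) ''
        (Ideal.span (Set.range s) : Set (X.presheaf.stalk x)))) → y ∈ Ideal.span (Set.range s))
    (hsoc : ∀ d : ℕ, ringKrullDim (X.presheaf.stalk x) = d → ∀ s : Fin d → X.presheaf.stalk x,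
      (Ideal.span (Set.range s)).radical.IsMaximal →
      ∃ t : X.presheaf.stalk x, (Ideal.span (Set.range s)).colon
        (IsLocalRing.maximalIdeal (X.presheaf.stalk x) : Set (X.presheaf.stalk x)) =
        Ideal.span (Set.range s) ⊔ Ideal.span {t}) :
    ∀ I : Ideal (X.presheaf.stalk x), ∀ y c : X.presheaf.stalk x, c ≠ 0 →
      (∀ e : ℕ, c * y ^ p ^ e ∈ Ideal.span ((fun z : X.presheaf.stalk x => z ^ p ^ e) ''
        (I : Set (X.presheaf.stalk x)))) → y ∈ I := by
  haveI : IsLocallyNoetherian X := LocallyOfFiniteType.isLocallyNoetherian f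
  intro I y c hc hy
  exact Theorems.FRationalResolution.weaklyFRegular_of_fRational_of_socle_cyclic p
    (X.presheaf.stalk x) hFR hsoc I y c hc hy

/-! ## X₁ · Stub 2 — spreading out (OPEN) -/

/-- STUB (OPEN — SPREADING OUT; engine: generic F-regularization along the top-dimensional stratum of
the non-weakly-F-regular locus `V(τ)` by blowing up test-ideal centres, iterated by Noetherian
induction — card `test-ideal-rung-to-f-regular`; the Gorenstein points of `V(Sing)` need no work by
Stub 1). An integral separated finite-type `X/k` with F-rational stalks has a proper birational
INTEGRAL model `X' → X` with F-rational stalks such that, off a finite set of points of `X'`, every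
stalk either has every ideal tightly closed (weakly F-regular) or has all its parameter ideals with
cyclic socle (Gorenstein). Summit-implied (a resolution qualifies with the empty exceptional set);
not the piece (the finitely many residual points are exactly what Stub 3 must treat). -/
theorem stub_spreadOut (p : ℕ) (hp : p.Prime) (k : Type) [Field k] [CharP k p]
    (X : Scheme.{0}) (f : X ⟶ Spec (.of k)) [IsSeparated f] [LocallyOfFiniteType f]
    [QuasiCompact f] [IsIntegral X]
    (hFR : ∀ x : X, IsDomain (X.presheaf.stalk x) ∧ ∀ d : ℕ, ringKrullDim (X.presheaf.stalk x) = d →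
      ∀ s : Fin d → X.presheaf.stalk x, (Ideal.span (Set.range s)).radical.IsMaximal →
      ∀ y c : X.presheaf.stalk x, c ≠ 0 →
      (∀ e : ℕ, c * y ^ p ^ e ∈ Ideal.span ((fun z : X.presheaf.stalk x => z ^ p ^ e) ''
        (Ideal.span (Set.range s) : Set (X.presheaf.stalk x)))) → y ∈ Ideal.span (Set.range s)) :
    ∃ (X' : Scheme.{0}) (π : X' ⟶ X), IsProper π ∧ IsBirational π ∧ IsIntegral X' ∧
      (∀ x : X', IsDomain (X'.presheaf.stalk x) ∧ ∀ d : ℕ, ringKrullDim (X'.presheaf.stalk x) = d →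
        ∀ s : Fin d → X'.presheaf.stalk x, (Ideal.span (Set.range s)).radical.IsMaximal →
        ∀ y c : X'.presheaf.stalk x, c ≠ 0 →
        (∀ e : ℕ, c * y ^ p ^ e ∈ Ideal.span ((fun z : X'.presheaf.stalk x => z ^ p ^ e) ''
          (Ideal.span (Set.range s) : Set (X'.presheaf.stalk x)))) → y ∈ Ideal.span (Set.range s)) ∧
      Set.Finite {x : X' | ¬ ((∀ I : Ideal (X'.presheaf.stalk x), ∀ y c : X'.presheaf.stalk x, c ≠ 0 →
          (∀ e : ℕ, c * y ^ p ^ e ∈ Ideal.span ((fun z : X'.presheaf.stalk x => z ^ p ^ e) ''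
            (I : Set (X'.presheaf.stalk x)))) → y ∈ I) ∨
        (∀ d : ℕ, ringKrullDim (X'.presheaf.stalk x) = d → ∀ s : Fin d → X'.presheaf.stalk x,
          (Ideal.span (Set.range s)).radical.IsMaximal →
          ∃ t : X'.presheaf.stalk x, (Ideal.span (Set.range s)).colon
            (IsLocalRing.maximalIdeal (X'.presheaf.stalk x) : Set (X'.presheaf.stalk x)) =
            Ideal.span (Set.range s) ⊔ Ideal.span {t}))} := by
  sorry

/-! ## X₁ · Stub 3 — the punctual engine (OPEN) -/

/-- STUB (OPEN — ISOLATED F-REGULARIZATION; the punctual engine: blow up test-ideal-built centres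
supported at the finitely many bad points, with the colength of `τ` as the budget; dimension 2 is
Lipman 1969 (complete ideals in rational surface singularities blow up to rational singularities) +
Hara 1998 (F-regular = log terminal for `p > 5`), card `test-ideal-rung-to-f-regular` §(3)). An
integral separated finite-type `X/k` with F-rational stalks whose points with a non-weakly-F-regular
stalk form a FINITE set has a proper birational model all of whose stalks are domains with every
ideal tightly closed. Summit-implied; not the piece (finiteness of the bad locus is a genuine
restriction from dimension 3 on: the non-F-regular locus of an F-rational threefold can be a curve,
e.g. a trivial family of Watanabe–Singh F-rational non-F-regular points). -/
theorem stub_isolatedFRegularization (p : ℕ) (hp : p.Prime) (k : Type) [Field k] [CharP k p]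
    (X : Scheme.{0}) (f : X ⟶ Spec (.of k)) [IsSeparated f] [LocallyOfFiniteType f]
    [QuasiCompact f] [IsIntegral X]
    (hFR : ∀ x : X, IsDomain (X.presheaf.stalk x) ∧ ∀ d : ℕ, ringKrullDim (X.presheaf.stalk x) = d →
      ∀ s : Fin d → X.presheaf.stalk x, (Ideal.span (Set.range s)).radical.IsMaximal →
      ∀ y c : X.presheaf.stalk x, c ≠ 0 →
      (∀ e : ℕ, c * y ^ p ^ e ∈ Ideal.span ((fun z : X.presheaf.stalk x => z ^ p ^ e) ''
        (Ideal.span (Set.range s) : Set (X.presheaf.stalk x)))) → y ∈ Ideal.span (Set.range s))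
    (hfin : Set.Finite {x : X | ¬ (∀ I : Ideal (X.presheaf.stalk x), ∀ y c : X.presheaf.stalk x, c ≠ 0 →
      (∀ e : ℕ, c * y ^ p ^ e ∈ Ideal.span ((fun z : X.presheaf.stalk x => z ^ p ^ e) ''
        (I : Set (X.presheaf.stalk x)))) → y ∈ I)}) :
    ∃ (X' : Scheme.{0}) (π : X' ⟶ X), IsProper π ∧ IsBirational π ∧
      ∀ x : X', IsDomain (X'.presheaf.stalk x) ∧ ∀ I : Ideal (X'.presheaf.stalk x),
        ∀ y c : X'.presheaf.stalk x, c ≠ 0 →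
        (∀ e : ℕ, c * y ^ p ^ e ∈ Ideal.span ((fun z : X'.presheaf.stalk x => z ^ p ^ e) ''
          (I : Set (X'.presheaf.stalk x)))) → y ∈ I := by
  sorry

/-! ## X₁ · Composition -/

/-- The piece BY NAME from the stubs: spread out (Stub 2), excuse the Gorenstein points (Stub 1),
regularize the finitely many remaining points (Stub 3), compose the proper birational maps. -/
theorem WeaklyFRegularModification_of : WeaklyFRegularModification := by
  intro p hp k _ _ X f hsep hft hqc hint hFR
  haveI := hsep
  haveI := hft
  haveI := hqc
  haveI := hint
  obtain ⟨X', π, hπ, hbir, hint', hFR', hfin⟩ := stub_spreadOut p hp k X f hFR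
  haveI := hπ
  haveI := hint'
  have hfin' : Set.Finite {x : X' | ¬ (∀ I : Ideal (X'.presheaf.stalk x),
      ∀ y c : X'.presheaf.stalk x, c ≠ 0 →
      (∀ e : ℕ, c * y ^ p ^ e ∈ Ideal.span ((fun z : X'.presheaf.stalk x => z ^ p ^ e) ''
        (I : Set (X'.presheaf.stalk x)))) → y ∈ I)} := by
    refine hfin.subset fun x hx => ?_
    simp only [Set.mem_setOf_eq] at hx ⊢
    intro h
    rcases h with h | h
    · exact hx h
    · exact hx (stub_gorensteinSector p k X' (π ≫ f) x (hFR' x).2 h)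
  obtain ⟨X'', π', hπ', hbir', hW⟩ :=
    stub_isolatedFRegularization p hp k X' (π ≫ f) hFR' hfin'
  haveI := hπ'
  exact ⟨X'', π' ≫ π, inferInstance, hbir'.comp hbir, hW⟩

/-! ## X₂ · Stub 1 — lrq-ification (OPEN, the hard half) -/

/-- STUB (OPEN — LRQ-IFICATION OF WEAKLY F-REGULAR VARIETIES). An integral separated finite-type
`X/k` (`char k = p`) whose stalks have every ideal tightly closed admits a proper birational INTEGRAL
model `X' → X` with DIAGONALIZABLE QUOTIENT SINGULARITIES presented by regular charts: every point of
`X'` lies in the image of an étale `k`-morphism `Spec S₀ → X'`, where `S` is a finitely generated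
REGULAR `k`-algebra graded by a finite abelian group `A` (an action of the finite diagonalizable,
hence linearly reductive, group scheme `D(A) = Spec k[A]` on `Spec S`) and `S₀` is its degree-`0`
part (`Spec S₀ = Spec S / D(A)`). Teeth: CST arXiv:1606.04088, Carvajal-Rojas arXiv:1710.06887,
LMM arXiv:2102.01067 Thm 1.6 (dimension 2: `X' = X`); simplicial toric singularities are exactly of
this form in every characteristic; the price is the suspension calibration (`yz + f` is F-regular for
every `f`). -/
theorem stub_quotientModel (p : ℕ) (hp : p.Prime) (k : Type) [Field k] [CharP k p]
    (X : Scheme.{0}) (f : X ⟶ Spec (.of k)) [IsSeparated f] [LocallyOfFiniteType f]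
    [QuasiCompact f] [IsIntegral X]
    (hW : ∀ x : X, IsDomain (X.presheaf.stalk x) ∧ ∀ I : Ideal (X.presheaf.stalk x),
      ∀ y c : X.presheaf.stalk x, c ≠ 0 →
      (∀ e : ℕ, c * y ^ p ^ e ∈ Ideal.span ((fun z : X.presheaf.stalk x => z ^ p ^ e) ''
        (I : Set (X.presheaf.stalk x)))) → y ∈ I) :
    ∃ (X' : Scheme.{0}) (π : X' ⟶ X), IsProper π ∧ IsBirational π ∧ IsIntegral X' ∧
      ∀ x : X', ∃ (A : Type) (_ : AddCommGroup A) (_ : Finite A) (_ : DecidableEq A)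
        (S : Type) (_ : CommRing S) (_ : Algebra k S) (𝒮 : A → Submodule k S)
        (_ : GradedAlgebra 𝒮), Algebra.FiniteType k S ∧ IsRegularRing S ∧
        ∃ φ : Spec (.of (𝒮 0)) ⟶ X', Etale φ ∧ x ∈ Set.range φ ∧
          φ ≫ π ≫ f = Spec.map (CommRingCat.ofHom (algebraMap k (𝒮 0))) := by
  sorry

/-! ## X₂ · Stub 2 — resolution of diagonalizable quotient singularities (printed for perfect `k`) -/

/-- STUB (RESOLUTION OF DIAGONALIZABLE QUOTIENT SINGULARITIES, every field): an integral separated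
finite-type `X/k` every point of which lies in the image of an étale `k`-morphism from the degree-`0`
part of a finitely generated REGULAR `k`-algebra graded by a finite abelian group has a resolution of
singularities. For PERFECT `k` this is Bergh–Rydh arXiv:1905.00872 Thm 5 (destackification), in the
tree as the named fact `BerghRydh2019_diagonalizableQuotientResolution` (regular = smooth for finitely
generated algebras over a perfect field, `smooth_of_isRegular_of_perfectField`); toroidal alternative:
a linearly reductive action on a regular local ring linearises on an `A`-homogeneous regular system
of parameters, so `Spec S₀` is toroidal and resolved combinatorially (Włodarczyk 2020). The
imperfect-field case with regular (not smooth) charts is the stub's own risk. -/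
theorem stub_diagonalizableQuotientResolution (k : Type) [Field k] (X : Scheme.{0})
    (g : X ⟶ Spec (.of k)) [IsIntegral X] [IsSeparated g] [LocallyOfFiniteType g] [QuasiCompact g]
    (hq : ∀ x : X, ∃ (A : Type) (_ : AddCommGroup A) (_ : Finite A) (_ : DecidableEq A)
        (S : Type) (_ : CommRing S) (_ : Algebra k S) (𝒮 : A → Submodule k S)
        (_ : GradedAlgebra 𝒮), Algebra.FiniteType k S ∧ IsRegularRing S ∧
        ∃ φ : Spec (.of (𝒮 0)) ⟶ X, Etale φ ∧ x ∈ Set.range φ ∧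
          φ ≫ g = Spec.map (CommRingCat.ofHom (algebraMap k (𝒮 0)))) :
    Scheme.HasResolution X := by
  sorry

/-! ## X₂ · Glue (proved): the weakly-F-regular clause transports along ring isomorphisms -/

/-- The piece's inline stalk clause ("domain, and EVERY ideal tightly closed") transports along a
ring isomorphism (used along the stalk isomorphisms of an open immersion). -/
theorem weaklyFRegularClause_of_ringEquiv (p : ℕ) {R T : Type} [CommRing R] [CommRing T]
    (φ : R ≃+* T)
    (h : IsDomain R ∧ ∀ I : Ideal R, ∀ y c : R, c ≠ 0 →
      (∀ e : ℕ, c * y ^ p ^ e ∈ Ideal.span ((fun z : R => z ^ p ^ e) '' (I : Set R))) → y ∈ I) :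
    IsDomain T ∧ ∀ I : Ideal T, ∀ y c : T, c ≠ 0 →
      (∀ e : ℕ, c * y ^ p ^ e ∈ Ideal.span ((fun z : T => z ^ p ^ e) '' (I : Set T))) → y ∈ I := by
  obtain ⟨hdom, htc⟩ := h
  refine ⟨MulEquiv.isDomain R φ.symm.toMulEquiv, fun I y c hc hmem => ?_⟩
  have hcR : φ.symm c ≠ 0 := φ.symm.map_ne_zero_iff.mpr hc
  have hyR : φ.symm y ∈ I.comap φ :=
    htc (I.comap φ) (φ.symm y) (φ.symm c) hcR fun e =>
      Theorems.FRationalResolution.ClauseInvariance.symm_mem_span_pow_image φ p e I (hmem e)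
  rw [Ideal.mem_comap, RingEquiv.apply_symm_apply] at hyR
  exact hyR

/-! ## X₂ · Composition -/

/-- The INTEGRAL CORE from the two stubs: an integral weakly F-regular `X/k` has a resolution
(lrq-ify, resolve the quotient model, transport down the model). -/
theorem integralCore (p : ℕ) (hp : p.Prime) (k : Type) [Field k] [CharP k p]
    (X : Scheme.{0}) (f : X ⟶ Spec (.of k)) [IsSeparated f] [LocallyOfFiniteType f] [QuasiCompact f]
    [IsIntegral X]
    (hW : ∀ x : X, IsDomain (X.presheaf.stalk x) ∧ ∀ I : Ideal (X.presheaf.stalk x),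
      ∀ y c : X.presheaf.stalk x, c ≠ 0 →
      (∀ e : ℕ, c * y ^ p ^ e ∈ Ideal.span ((fun z : X.presheaf.stalk x => z ^ p ^ e) ''
        (I : Set (X.presheaf.stalk x)))) → y ∈ I) :
    Scheme.HasResolution X := by
  obtain ⟨X', π, hπ, hbir, hint', hq⟩ := stub_quotientModel p hp k X f hW
  haveI := hπ
  haveI := hint'
  refine Scheme.HasResolution.of_isBirational π hbir ?_
  exact stub_diagonalizableQuotientResolution k X' (π ≫ f) (fun x => by
    obtain ⟨A, iA, fA, dA, S, iS, aS, 𝒮, gS, hft, hreg, φ, hφ, hx, hcomp⟩ := hq x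
    exact ⟨A, iA, fA, dA, S, iS, aS, 𝒮, gS, hft, hreg, φ, hφ, hx, by rw [← hcomp]⟩)

/-- The piece BY NAME from the stubs (components + transport of the clause + `integralCore`). -/
theorem WeaklyFRegularResolution_of : WeaklyFRegularResolution := by
  intro p hp k _ _ X f hsep hft hqc hW
  haveI := hsep
  haveI := hft
  haveI := hqc
  refine Theorems.FRationalResolution.Components.stub_components k X f (fun x => (hW x).1)
    fun U j hj hU => ?_
  haveI := hj
  haveI := hU
  haveI : IsLocallyNoetherian X := LocallyOfFiniteType.isLocallyNoetherian f
  haveI : CompactSpace X := QuasiCompact.compactSpace_of_compactSpace f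
  haveI : IsNoetherian X := { }
  haveI : NoetherianSpace U := j.isOpenEmbedding.isInducing.noetherianSpace
  refine integralCore p hp k U (j ≫ f) fun u => ?_
  exact weaklyFRegularClause_of_ringEquiv p (asIso (j.stalkMap u)).commRingCatIsoToRingEquiv
    (hW (j.base u))


/-! ## TORIC SURFACE PROGRAMME (lead c4): rung 4′ on all affine toric surfaces, every field

Objects (no new definitions — terms under local notation, as in the `A_n` programme):
* `Lk = k[ℤ²] = AddMonoidAlgebra k (ℤ × ℤ)`, the coordinate ring of the torus, monomials `χᵐ = single m 1`;
* `σS[r, a] = {m : ℤ × ℤ | 0 ≤ m.2 ∧ a * m.2 ≤ r * m.1}` = lattice points of `σ∨`, `σ = cone((0,1), (r,−a))`;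
* `TA[r, a] = k[σS[r,a]] ⊆ Lk` (the `k`-subalgebra generated by those monomials), `U(r,a) = Spec TA[r,a]`:
  for `0 ≤ a < r` the affine toric surface of the cone `σ`, i.e. the cyclic quotient singularity `1/r(1,a)`
  when `gcd(r,a) = 1` (and `TA[r,a] = TA[r/g, a/g]` literally otherwise); `TA[r,0] = k[ℕ²]`.
* distinguished monomials `x = χ^(1,0)`, `xy = χ^(1,1)`, `w = χ^(a,r)` of `TA[r,a]` (the two facet generators
  of `σ∨` are `x` and `w`; the torus-fixed point is `V(x, w)`).

THE STEP (`1 ≤ a < r`, `d = ⌈r/a⌉`, `a′ = d a − r < a`): `π₀ : Bl_I U(r,a) → U(r,a)`, `I = (xy, x, x) = (x, xy)`,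
is proper, an iso over `D(x)` (a generator) AND over `D(w)` (`I·TA[r,a]_w = (xy)` is principal:
`stub_toric_isIso_away_w`); its two charts are `D₊(x t) = Spec TA[r,a][xy/x] = Spec k[x, y] = 𝔸²`
(`stub_toric_xChart_isRegularRing`) and `D₊(xy t) = Spec TA[r,a][x/xy] = Spec k[{0 ≤ m₁, a m₂ ≤ r m₁}]`
(`stub_toric_yChart_carrier`, inside `Lk = TA[r,a][1/xy]`, `stub_toric_isLocalization_away`), and the
unimodular substitution `θ(m) = (m₂, d m₂ − m₁)` carries `TA[a, a′]` onto the latter (`stub_toric_theta`), taking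
`x′ ↦ y⁻¹ = x/xy` and `w′ ↦ w`. Hence (`towerStep`, invariant "iso over `D(x) ∪ D(w)` with dense preimage", which
makes the regular open of the recursive chart free): `P(a, a′) ⇒ P(r, a)`; `P(r, 0)` holds with the identity
(`stub_toric_base_isRegularRing`); strong induction on `r` gives `P(r,a)` for all `a < r`, and
`hasResolution_toricSurface`. Finite type (`stub_toric_finiteType`, Gordan) is what places `U(r,a)` in the crux's
class (with the direct-summand retract onto `k[ℕ²]`, next wave).
-/

section Toric

variable (k : Type) [Field k]

/-- The Laurent polynomial ring `k[ℤ²]` (coordinate ring of the 2-torus). -/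
local notation3 "Lk" => AddMonoidAlgebra k (ℤ × ℤ)

/-- The lattice points of the dual cone `σ∨ = {m₂ ≥ 0, a m₂ ≤ r m₁}` of `σ = cone((0,1),(r,-a))`. -/
local notation3 "σS[" r ", " a "]" =>
  {m : ℤ × ℤ | 0 ≤ m.2 ∧ ((a : ℕ) : ℤ) * m.2 ≤ ((r : ℕ) : ℤ) * m.1}

/-- The toric surface algebra `k[σ∨ ∩ ℤ²] ⊆ k[ℤ²]`. -/
local notation3 "TA[" r ", " a "]" =>
  Algebra.adjoin k ((fun m : ℤ × ℤ => AddMonoidAlgebra.single m (1 : k)) '' σS[r, a])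

/-! ### Worker stubs (wave 1) -/

/-- STUB (base of the tower): `TA[r, 0] = k[ℕ²]` (the monomials with support in `{0 ≤ m₂, 0 ≤ m₁}`) is a
regular ring — it is `k`-isomorphic to `MvPolynomial (Fin 2) k` (`AddMonoidAlgebra.domCongr` /
`mapDomain` along `ℕ² ↪ ℤ²`; Mathlib: polynomial rings over a field are `IsRegularRing`). [folklore] -/
theorem stub_toric_base_isRegularRing (r : ℕ) (hr : 1 ≤ r) : IsRegularRing ↥TA[r, 0] :=
  Theorems.FRationalResolution.stub_toric_base_isRegularRing k r hr  -- LANDED p164828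

/-- STUB (the `x`-chart of `Bl_{(x,xy)} U(r,a)` is an affine plane): for `a ≤ r`, `1 ≤ r`, the affine
blow-up algebra `TA[r,a][I/x] ⊆ TA[r,a][1/x]`, `I = (xy, x, x)`, i.e. `TA[r,a][xy/x] = k[x, y]`, is a regular
ring: the `k`-algebra map `MvPolynomial (Fin 2) k → TA[r,a][1/x]`, `X 0 ↦ x/1`, `X 1 ↦ (xy/1)·(x/1)⁻¹` is
injective (compose with `TA[r,a][1/x] → Lk`, `x ↦ χ^(1,0)` a unit, and compare monomials) with range
`blowupAlgebra I x` (every monomial `χ^(m₁,m₂)` of `σS[r,a]` has `m₁, m₂ ≥ 0` and equals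
`(x/1)^m₁ ((xy/1)(x/1)⁻¹)^m₂`). [folklore; CoxLittleSchenck2011 §10.1] -/
theorem stub_toric_xChart_isRegularRing (r a : ℕ) (hr : 1 ≤ r) (har : a ≤ r) (x xy : ↥TA[r, a])
    (hx : (x : Lk) = AddMonoidAlgebra.single ((1 : ℤ), (0 : ℤ)) 1)
    (hxy : (xy : Lk) = AddMonoidAlgebra.single ((1 : ℤ), (1 : ℤ)) 1) :
    IsRegularRing ↥(blowupAlgebra (Ideal.span {xy, x, x}) x) :=
  Theorems.FRationalResolution.stub_toric_xChart_isRegularRing k r a hr har x xy hx hxy  -- LANDED p165031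

/-- STUB (`Lk = TA[r,a][1/xy]`): for `a < r` the torus algebra `k[ℤ²]` is the localization of `TA[r,a]` at
the interior monomial `xy = χ^(1,1)`: `χ^(1,1)` is a unit of `Lk` (inverse `χ^(-1,-1)`), the structure map is
the (injective) inclusion, and every `ℓ ∈ Lk` has `ℓ · χ^(n,n) ∈ TA[r,a]` for `n ≫ 0` (for a lattice point
`m`, `m + (n,n) ∈ σS[r,a]` as soon as `n ≥ -m₂` and `n (r - a) ≥ a m₂ - r m₁`). [folklore] -/
theorem stub_toric_isLocalization_away (r a : ℕ) (har : a < r) (xy : ↥TA[r, a])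
    (hxy : (xy : Lk) = AddMonoidAlgebra.single ((1 : ℤ), (1 : ℤ)) 1) :
    IsLocalization.Away xy Lk :=
  Theorems.FRationalResolution.stub_toric_isLocalization_away k r a har xy hxy  -- LANDED p164967

/-- STUB (the unimodular substitution): for `1 ≤ a`, `a′ + r = d a`, `a′ < a`, the lattice automorphism
`θ(m₁, m₂) = (m₂, d m₂ − m₁)` of `ℤ²` (inverse `(n₁, n₂) ↦ (d n₁ − n₂, n₁)`, determinant `1`) induces a
`k`-algebra automorphism `Θ = AddMonoidAlgebra.domCongr` of `Lk` with `Θ χᵐ = χ^θ(m)`, and `θ` maps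
`σS[a, a′] = {0 ≤ n₂, a′ n₂ ≤ a n₁}` ONTO `{0 ≤ m₁, a m₂ ≤ r m₁}` (check: `m₁ = n₂ ≥ 0`;
`a m₂ ≤ r m₁ ⇔ a (d n₂ − n₁) ≤ r n₂ ⇔ (d a − r) n₂ ≤ a n₁ ⇔ a′ n₂ ≤ a n₁`), so `Θ` maps `TA[a, a′]` onto the
`k`-subalgebra generated by the monomials of the latter set (`AlgHom.map_adjoin`). [folklore; CLS2011 §10.2] -/
theorem stub_toric_theta (r a d a' : ℕ) (ha : 1 ≤ a) (hda : a' + r = d * a) (ha'a : a' < a) :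
    ∃ Θ : Lk ≃ₐ[k] Lk,
      (∀ m : ℤ × ℤ, Θ (AddMonoidAlgebra.single m 1) =
        AddMonoidAlgebra.single (m.2, (d : ℤ) * m.2 - m.1) 1) ∧
      Subalgebra.map Θ.toAlgHom TA[a, a'] =
        Algebra.adjoin k ((fun m : ℤ × ℤ => AddMonoidAlgebra.single m (1 : k)) ''
          {m : ℤ × ℤ | 0 ≤ m.1 ∧ ((a : ℕ) : ℤ) * m.2 ≤ ((r : ℕ) : ℤ) * m.1}) :=
  Theorems.FRationalResolution.stub_toric_theta k r a d a' ha hda ha'a  -- LANDED p164781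

/-- STUB (the `xy`-chart of `Bl_{(x,xy)} U(r,a)` inside the torus algebra): for `a < r` and ANY
`TA[r,a]`-algebra isomorphism `e : TA[r,a][1/xy] ≅ Lk` (one exists by `stub_toric_isLocalization_away`), the
image of the affine blow-up algebra `TA[r,a][I/xy]`, `I = (xy, x, x)`, is the `k`-subalgebra of `Lk` generated by
the monomials of `{0 ≤ m₁, a m₂ ≤ r m₁} = σS[r,a] + ℕ·(0,−1)`: `blowupAlgebra I xy = TA[r,a][x/xy]`
(generators `xy/xy = 1`, `x/xy`), `e (x/xy) = e(x/1) e(xy/1)⁻¹ = χ^(1,0) χ^(−1,−1) = χ^(0,−1) = y⁻¹`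
(`e` is a `TA[r,a]`-algebra map and `χ^(1,1)` is a unit of `Lk`), and a lattice point `m` with `0 ≤ m₁`,
`a m₂ ≤ r m₁` is `(m₁, max m₂ 0) + (min m₂ 0)·(0,1)` with `(m₁, max m₂ 0) ∈ σS[r,a]`. [folklore] -/
theorem stub_toric_yChart_carrier (r a : ℕ) (har : a < r) (x xy : ↥TA[r, a])
    (hx : (x : Lk) = AddMonoidAlgebra.single ((1 : ℤ), (0 : ℤ)) 1)
    (hxy : (xy : Lk) = AddMonoidAlgebra.single ((1 : ℤ), (1 : ℤ)) 1)
    (e : Localization.Away xy ≃ₐ[↥TA[r, a]] Lk) :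
    (Subalgebra.map e.toAlgHom (blowupAlgebra (Ideal.span {xy, x, x}) xy)).restrictScalars k =
      Algebra.adjoin k ((fun m : ℤ × ℤ => AddMonoidAlgebra.single m (1 : k)) ''
        {m : ℤ × ℤ | 0 ≤ m.1 ∧ ((a : ℕ) : ℤ) * m.2 ≤ ((r : ℕ) : ℤ) * m.1}) :=
  Theorems.FRationalResolution.stub_toric_yChart_carrier k r a har x xy hx hxy e  -- LANDED p164903

/-- STUB (the blow-down is an isomorphism over `D(w)`, `w = χ^(a,r)` the second facet generator): for
`1 ≤ a ≤ r`, over the basic open `D(w) = Spec TA[r,a][1/w]` the centre `I = (xy, x, x)` becomes the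
principal ideal `(xy)` generated by a non-zero-divisor (`y⁻¹ = χ^(a, r−1)/w ∈ TA[r,a][1/w]`, so
`x = xy · y⁻¹ ∈ (xy)`), hence the pulled-back ideal sheaf is an effective Cartier divisor and the restricted
blow-up `π₀ ∣_ D(w)` — a blow-up of it, `(affineBlowup.isBlowup I).restrict` — is an isomorphism
(`IsBlowup.isIso`). [folklore; GortzWedhorn2020 Prop. 13.91] -/
theorem stub_toric_isIso_away_w (r a : ℕ) (ha : 1 ≤ a) (har : a ≤ r) (x xy w : ↥TA[r, a])
    (hx : (x : Lk) = AddMonoidAlgebra.single ((1 : ℤ), (0 : ℤ)) 1)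
    (hxy : (xy : Lk) = AddMonoidAlgebra.single ((1 : ℤ), (1 : ℤ)) 1)
    (hw : (w : Lk) = AddMonoidAlgebra.single ((a : ℤ), (r : ℤ)) 1) :
    IsIso (affineBlowup.π (Ideal.span {xy, x, x}) ∣_
      (PrimeSpectrum.basicOpen w : (Spec (CommRingCat.of ↥TA[r, a])).Opens)) :=
  Theorems.FRationalResolution.stub_toric_isIso_away_w k r a ha har x xy w hx hxy hw  -- LANDED p165100

/-- STUB (Gordan's lemma for the cone `σ∨`, explicit form): for `1 ≤ r`, `a ≤ r` the algebra `TA[r,a]` is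
of finite type over `k` — generated by the monomials `χ^(1,0)`, `χ^(a,r)` and `χ^(⌈aρ/r⌉, ρ)`, `0 ≤ ρ < r`
(for `m ∈ σS[r,a]` write `m₂ = q r + ρ`; then `m − q (a,r) ∈ σS[r,a]` has second coordinate `ρ`, and
`(m₁, ρ) = (m₁ − ⌈aρ/r⌉)(1,0) + (⌈aρ/r⌉, ρ)` with `m₁ ≥ ⌈aρ/r⌉`). [folklore; CLS2011 Prop. 1.2.17] -/
theorem stub_toric_finiteType (r a : ℕ) (hr : 1 ≤ r) (har : a ≤ r) : Algebra.FiniteType k ↥TA[r, a] :=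
  Theorems.FRationalResolution.stub_toric_finiteType k r a hr har  -- LANDED p164881

/-! ### Worker stubs (wave 2): `U(r,a)` lies in the crux's class; the vertex -/

/-- STUB (the torus-fixed point is the only point outside `D(x) ∪ D(w)`): for `1 ≤ r`, two primes of
`TA[r,a]` both containing `x = χ^(1,0)` and `w = χ^(a,r)` coincide — each contains every non-constant
monomial `χᵐ`, `m ∈ σS[r,a] ∖ 0` (since `(χᵐ)^r = x^(r m₁ − a m₂) · w^(m₂)` with natural exponents not both
zero), hence consists exactly of the elements of `TA[r,a]` with zero constant coefficient (`TA[r,a]` is the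
`k`-span of its monomials). [folklore; CLS2011 §1.2] -/
theorem stub_toric_point_eq (r a : ℕ) (hr : 1 ≤ r) (x w : ↥TA[r, a])
    (hx : (x : Lk) = AddMonoidAlgebra.single ((1 : ℤ), (0 : ℤ)) 1)
    (hw : (w : Lk) = AddMonoidAlgebra.single ((a : ℤ), (r : ℤ)) 1)
    (P Q : PrimeSpectrum ↥TA[r, a]) (hP : x ∈ P.asIdeal ∧ w ∈ P.asIdeal)
    (hQ : x ∈ Q.asIdeal ∧ w ∈ Q.asIdeal) : P = Q :=
  Theorems.FRationalResolution.stub_toric_point_eq k r a hr x w hx hw P Q hP hQ  -- LANDED p166810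

/-- STUB (finite type, scheme form): `U(r,a) → Spec k` is locally of finite type (`stub_toric_finiteType` +
Mathlib's `HasRingHomProperty` description of `LocallyOfFiniteType` on `Spec` of an algebra map; cf. c3's
`An_locallyOfFiniteType`). [folklore] -/
theorem stub_toric_locallyOfFiniteType (r a : ℕ) (hr : 1 ≤ r) (har : a ≤ r) :
    LocallyOfFiniteType (Spec.map (CommRingCat.ofHom (algebraMap k ↥TA[r, a]))) :=
  Theorems.FRationalResolution.stub_toric_locallyOfFiniteType k r a hr har  -- LANDED p167091

/-- STUB (`TA[r,a]` is a DIRECT SUMMAND of the polynomial ring `TA[1,0] = k[ℕ²]`): for `1 ≤ r` the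
injective lattice map `λ(m₁,m₂) = (m₂, r m₁ − a m₂)` (determinant `−r`) satisfies
`m ∈ σS[r,a] ⇔ λ(m) ∈ ℕ²`, so `Λ = mapDomain λ` embeds `TA[r,a]` into `TA[1,0]` with image the monomials whose
exponent lies in the index-`r` sublattice `H = λ(ℤ²) = {n : r ∣ n₂ + a n₁}`; the projection `ρ` onto those
monomials followed by `λ⁻¹(n) = ((n₂ + a n₁)/r, n₁)` is additive, `TA[r,a]`-linear (`n ∈ H ⇔ λ(m) + n ∈ H`)
and retracts `Λ`. (No group action is needed; this is the Reynolds operator of `μ_r` written on exponents,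
valid also when `p ∣ r`.) [folklore; BrunsHerzog1998 §6.1, Hochster 1972] -/
theorem stub_toric_retract (r a : ℕ) (hr : 1 ≤ r) :
    ∃ (Λ : ↥TA[r, a] →+* ↥TA[1, 0]) (ρ : ↥TA[1, 0] →+ ↥TA[r, a]), Function.Injective Λ ∧
      (∀ t, ρ (Λ t) = t) ∧ (∀ t g, ρ (Λ t * g) = t * ρ g) :=
  Theorems.FRationalResolution.stub_toric_retract k r a hr  -- LANDED p167096

/-- STUB (direct summands localize; generic commutative algebra): if `Λ : R → S` is an injective ring map
with an additive retraction `ρ` that is `R`-linear (`ρ (Λ t · g) = t · ρ g`), then for every prime `P` of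
`R` the localization `R_P → S_{Λ(R∖P)}` is again injective with an `R_P`-linear additive retraction
(`ρ'(g / Λ u) = ρ g / u`: the localized module map of `ρ`), compatibly with the localization maps.
[folklore; HochsterHuneke1990 Prop. 4.12 proof] -/
theorem stub_retract_localization {R S : Type} [CommRing R] [CommRing S] (Λ : R →+* S) (ρ : S →+ R)
    (hΛ : Function.Injective Λ) (h1 : ∀ t, ρ (Λ t) = t) (h2 : ∀ t g, ρ (Λ t * g) = t * ρ g)
    (P : Ideal R) [P.IsPrime] :
    ∃ (Λ' : Localization.AtPrime P →+* Localization (P.primeCompl.map Λ))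
      (ρ' : Localization (P.primeCompl.map Λ) →+ Localization.AtPrime P),
      Function.Injective Λ' ∧ (∀ t, ρ' (Λ' t) = t) ∧ (∀ t g, ρ' (Λ' t * g) = t * ρ' g) ∧
      ∀ t : R, Λ' (algebraMap R _ t) = algebraMap S _ (Λ t) :=
  Theorems.FRationalResolution.stub_retract_localization Λ ρ hΛ h1 h2 P  -- LANDED p166832

/-- STUB (localizations of regular rings are regular; generic): every localization of a regular ring
(Mathlib `IsRegularRing`: Noetherian with regular local rings at all primes) is a regular ring — its
primes are primes of `R` and its local rings are local rings of `R`
(`IsLocalization.localizationLocalizationAtPrimeIsoLocalization`). [folklore; Matsumura1987 Thm. 19.3 context] -/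
theorem stub_isRegularRing_localization {R : Type} [CommRing R] [IsRegularRing R] (M : Submonoid R) :
    IsRegularRing (Localization M) :=
  Theorems.FRationalResolution.stub_isRegularRing_localization M  -- LANDED p166665

/-- STUB (direct summands of regular domains lie in the weakly-F-regular class; generic): if `S` is a
regular domain of characteristic `p` and `Λ : R → S` is injective with an `R`-linear additive retraction,
then `R` is a domain in which EVERY ideal is tightly closed (inline clause) — c1's
`weaklyFRegularClause_of_retract` (Hochster–Huneke 1990 Prop. 4.12) over `weaklyFRegularClause_of_isRegularRing`,
after installing `Λ` as the algebra structure. [cite: HochsterHuneke1990, Prop. 4.12] -/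
theorem stub_clause_of_retract_regular (p : ℕ) [Fact p.Prime] {R S : Type} [CommRing R] [CommRing S]
    [IsDomain S] [CharP S p] [IsRegularRing S] (Λ : R →+* S) (ρ : S →+ R)
    (hΛ : Function.Injective Λ) (h1 : ∀ t, ρ (Λ t) = t) (h2 : ∀ t g, ρ (Λ t * g) = t * ρ g) :
    IsDomain R ∧ ∀ I : Ideal R, ∀ y c : R, c ≠ 0 →
      (∀ e : ℕ, c * y ^ p ^ e ∈ Ideal.span ((fun z : R => z ^ p ^ e) '' (I : Set R))) → y ∈ I :=
  Theorems.FRationalResolution.stub_clause_of_retract_regular p Λ ρ hΛ h1 h2  -- LANDED p166623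

/-! ### Worker stubs (wave 3): dimension, singularity of the vertex, the diagonalizable-quotient presentation, all `(r, a)` -/

/-- STUB (`U(r,a)` is a surface): for `1 ≤ r`, `a ≤ r` the toric algebra has Krull dimension `2` — it is integral
over its subalgebra `k[x, w]` (`(χᵐ)^r = x^(r m₁ − a m₂) w^(m₂)`), which is a polynomial ring in the algebraically
independent monomials `x = χ^(1,0)`, `w = χ^(a,r)` (tree: `ringKrullDim_eq_of_isIntegral`; Mathlib: dimension of
`MvPolynomial (Fin 2) k`). [folklore; CLS2011 §1.2] -/
theorem stub_toric_ringKrullDim (r a : ℕ) (hr : 1 ≤ r) (har : a ≤ r) : ringKrullDim ↥TA[r, a] = 2 :=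
  Theorems.FRationalResolution.stub_toric_ringKrullDim k r a hr har  -- LANDED p168510

/-- STUB (the vertex of `U(r,a)` is SINGULAR for `1 ≤ a < r`): the prime `q ∋ x, w` (the vertex) is not a
regular point. The maximal ideal `𝔪 = q` is the `k`-span of the non-constant monomials and `𝔪²` that of the
monomials `χ^(m+m′)`, `m, m′ ∈ σS[r,a] ∖ 0`; the INDECOMPOSABLE monomials are `k`-independent modulo `𝔪²`, and there
are at least three of them: `χ^(1,0)`, `χ^(1,1)` (any `χ^(1,j)` is indecomposable since nonzero cone points have
`m₁ ≥ 1`) and a third one, because `χ^(a,r) ∉ k[χ^(1,0), χ^(1,1)]` (`r > a`) while every monomial is a product of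
indecomposables (descent on `m₁`); so `𝔪/𝔪²` has dimension `≥ 3 > 2 = dim` and `TA[r,a]_𝔪` is not regular
(denominator clearing as in c1's `veronese_not_isRegularRing`, or Mathlib's cotangent-space characterisation).
[folklore; CLS2011 Thm. 1.3.12 / Prop. 11.1.8] -/
theorem stub_toric_vertex_not_regular (r a : ℕ) (ha : 1 ≤ a) (har : a < r) (hdim : ringKrullDim ↥TA[r, a] = 2)
    (x w : ↥TA[r, a]) (hx : (x : Lk) = AddMonoidAlgebra.single ((1 : ℤ), (0 : ℤ)) 1)
    (hw : (w : Lk) = AddMonoidAlgebra.single ((a : ℤ), (r : ℤ)) 1)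
    (q : PrimeSpectrum ↥TA[r, a]) (hq : x ∈ q.asIdeal ∧ w ∈ q.asIdeal) :
    ¬ IsRegularLocalRing (Localization.AtPrime q.asIdeal) :=
  Theorems.FRationalResolution.stub_toric_vertex_not_regular k r a ha har hdim x w hx hw q hq  -- LANDED p168649

/-- STUB (the diagonalizable-quotient presentation `TA[r,a] = k[X₀, X₁]^{μ_r}`, weights `(a, 1)`, every field and
every `r ≥ 1` including `p ∣ r`): there is an injective `k`-algebra map `TA[r,a] → k[X₀, X₁]` (the lattice embedding
`λ(m₁,m₂) = (m₂, r m₁ − a m₂)`, `χᵐ ↦ X₀^(λ m).1 X₁^(λ m).2`, cf. `stub_toric_retract`) whose range is exactly the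
span of the monomials `X₀^d₀ X₁^d₁` with `r ∣ a d₀ + d₁`, i.e. the weight-`0` part for the `ℤ/r`-grading with weights
`(a, 1)` — the ring of invariants of `μ_r` acting by `(ζ^a, ζ)`. [folklore; CLS2011 §1.3, Ex. 1.3.20] -/
theorem stub_toric_weightZero (r a : ℕ) (hr : 1 ≤ r) :
    ∃ ε : ↥TA[r, a] →ₐ[k] MvPolynomial (Fin 2) k, Function.Injective ε ∧
      ∀ f : MvPolynomial (Fin 2) k, f ∈ Set.range ε ↔
        ∀ d ∈ f.support, (r : ℤ) ∣ (a : ℤ) * (d 0 : ℕ) + (d 1 : ℕ) :=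
  Theorems.FRationalResolution.stub_toric_weightZero k r a hr  -- LANDED p168494

/-- STUB (reduction of `a` modulo `r`): for `1 ≤ r` the lattice automorphism `(m₁, m₂) ↦ (m₁ − ⌊a/r⌋ m₂, m₂)`
carries `σS[r, a]` onto `σS[r, a % r]` (`a m₂ ≤ r m₁ ⇔ (a − r⌊a/r⌋) m₂ ≤ r (m₁ − ⌊a/r⌋ m₂)`), hence
(`AddMonoidAlgebra.domCongr`) `TA[r,a] ≅ TA[r, a % r]` as `k`-algebras. [folklore] -/
theorem stub_toric_reduce_mod (r a : ℕ) (hr : 1 ≤ r) : Nonempty (↥TA[r, a] ≃ₐ[k] ↥TA[r, a % r]) :=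
  Theorems.FRationalResolution.stub_toric_reduce_mod k r a hr  -- LANDED p168409

/-- STUB (the degenerate cones are regular): `TA[0, a]` is a regular ring — for `a ≥ 1` it is
`k[{m : m₂ = 0}] = k[t, t⁻¹]` and for `a = 0` it is `k[{m : 0 ≤ m₂}] = k[t, t⁻¹][s]`, both localizations of
polynomial rings (`IsLocalization.Away`, `stub_isRegularRing_localization`-style transport, or directly
`IsRegularRing.of_ringEquiv` from `Localization.Away (X 0) (MvPolynomial (Fin n) k)`). [folklore] -/
theorem stub_toric_degenerate_isRegularRing (a : ℕ) : IsRegularRing ↥TA[0, a] :=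
  Theorems.FRationalResolution.stub_toric_degenerate_isRegularRing k a  -- LANDED p168556

/-! ### Lead: the chart package, the step, the induction -/

/-- `P(r,a)`: `U(r,a)` receives a proper morphism from a regular scheme which is an isomorphism over
`D(x) ∪ D(w)` (the complement of the torus-fixed point) with dense preimage. For ALL `a < r`, every field.
Strong induction on `r` along `stub`s above and `towerStep`. [folklore; CLS2011 Thm. 10.1.10, §10.2] -/
theorem stub_toric_offVertex_resolution (r a : ℕ) (har : a < r) (x w : ↥TA[r, a])
    (hx : (x : Lk) = AddMonoidAlgebra.single ((1 : ℤ), (0 : ℤ)) 1)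
    (hw : (w : Lk) = AddMonoidAlgebra.single ((a : ℤ), (r : ℤ)) 1) :
    ∃ (Y : Scheme.{0}) (ρ : Y ⟶ Spec (CommRingCat.of ↥TA[r, a])), IsProper ρ ∧ Scheme.IsRegular Y ∧
      IsIso (ρ ∣_ ((PrimeSpectrum.basicOpen x ⊔ PrimeSpectrum.basicOpen w :
        (Spec (CommRingCat.of ↥TA[r, a])).Opens))) ∧
      Dense ((ρ ⁻¹ᵁ ((PrimeSpectrum.basicOpen x ⊔ PrimeSpectrum.basicOpen w :
        (Spec (CommRingCat.of ↥TA[r, a])).Opens)) : Y.Opens) : Set Y) :=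
  Theorems.FRationalResolution.stub_toric_offVertex_resolution k r a har x w hx hw  -- LANDED p166462 (lead)

/-- **RUNG 4′ ON ALL AFFINE TORIC SURFACES, EVERY FIELD.** For every field `k` and all `a < r`, the
toric surface `U(r,a) = Spec k[{m ∈ ℤ² : 0 ≤ m₂, a m₂ ≤ r m₁}]` — every cyclic quotient surface singularity
`1/r(1,a)`, i.e. every two-dimensional diagonalizable quotient `k[x,y]^{μ_r}` including the wild case
`p ∣ r` — HAS A RESOLUTION OF SINGULARITIES, by the Hirzebruch–Jung tower of two-chart monomial blow-ups.
[folklore; CLS2011 Thm. 10.1.10] -/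
theorem hasResolution_toricSurface (r a : ℕ) (har : a < r) :
    Scheme.HasResolution (Spec (CommRingCat.of ↥TA[r, a])) := by
  -- the distinguished monomials exist in `TA[r,a]`
  have hxmem : (AddMonoidAlgebra.single ((1 : ℤ), (0 : ℤ)) (1 : k) : Lk) ∈ TA[r, a] :=
    Algebra.subset_adjoin ⟨((1 : ℤ), (0 : ℤ)), ⟨le_refl _, by simp⟩, rfl⟩
  have hwmem : (AddMonoidAlgebra.single ((a : ℤ), (r : ℤ)) (1 : k) : Lk) ∈ TA[r, a] :=
    Algebra.subset_adjoin ⟨((a : ℤ), (r : ℤ)), ⟨by positivity, by rw [mul_comm]⟩, rfl⟩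
  obtain ⟨Y, ρ, hρ, hreg, hiso, hd⟩ :=
    stub_toric_offVertex_resolution k r a har ⟨_, hxmem⟩ ⟨_, hwmem⟩ rfl rfl
  haveI : IsDomain ↥TA[r, a] := inferInstance
  have hx0 : (⟨_, hxmem⟩ : ↥TA[r, a]) ≠ 0 := fun h0 => by
    have h1 := congrArg Subtype.val h0
    simp only [ZeroMemClass.coe_zero, AddMonoidAlgebra.single_eq_zero] at h1
    exact one_ne_zero h1
  have hdense : Dense (((PrimeSpectrum.basicOpen (⟨_, hxmem⟩ : ↥TA[r, a]) ⊔
      PrimeSpectrum.basicOpen (⟨_, hwmem⟩ : ↥TA[r, a]) :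
        (Spec (CommRingCat.of ↥TA[r, a])).Opens)) : Set (Spec (CommRingCat.of ↥TA[r, a]))) := by
    refine Dense.mono (fun p hp => Or.inl hp) ?_
    exact dense_basicOpen_of_ne_zero (R := ↥TA[r, a]) _ hx0
  exact ⟨Y, ρ, ⟨hρ, ⟨_, hdense, hd, hiso⟩, hreg⟩⟩

/-! ### Landed headline theorems of the programme (tree, namespace `…Theorems.FRationalResolution`)

* `hasResolution_toricSurface` (p166462) — rung 4′ on every `U(r,a)`, `a < r`, every field; `hasResolution_toricSurface_all`
  (…ToricAll, p169424, ALL `r, a`);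
* `toricSurface_residualClass`, `toricSurface_fRationalHypothesis` (p168210) — `U(r,a)` lies in the class of rung 4′ / of the crux;
* `hasResolution_fRational_surface_of_toric_stalks`, `local_resolution_of_toric_stalk` (p168211) — the crux for integral F-rational
  surfaces with toric singular stalks; (G2) for toric germs;
* `toricSurface_diagonalizableQuotient` (p169068) — `U(r,a)` satisfies VERBATIM the hypothesis of
  `stub_diagonalizableQuotientResolution` (`A = ZMod r`, weights `(a,1)`), so on this family the endgame stub is proved
  unconditionally; `toric_vertex_not_mem_regularLocus` (…ToricAll) — these members of the class are singular for `1 ≤ a < r`.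
-/

/-- The crux-class membership and the resolution of the affine toric surfaces, side by side (tree theorems). [folklore] -/
theorem toricSurface_inClass_and_resolved (p : ℕ) [Fact p.Prime] [CharP k p] (r a : ℕ) (har : a < r) :
    (∀ z : Spec (CommRingCat.of ↥TA[r, a]),
      IsDomain ((Spec (CommRingCat.of ↥TA[r, a])).presheaf.stalk z) ∧
      ∀ I : Ideal ((Spec (CommRingCat.of ↥TA[r, a])).presheaf.stalk z),
      ∀ y c : (Spec (CommRingCat.of ↥TA[r, a])).presheaf.stalk z, c ≠ 0 →
      (∀ e : ℕ, c * y ^ p ^ e ∈ Ideal.span ((fun w : (Spec (CommRingCat.of ↥TA[r, a])).presheaf.stalk z =>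
        w ^ p ^ e) '' (I : Set ((Spec (CommRingCat.of ↥TA[r, a])).presheaf.stalk z)))) → y ∈ I) ∧
    Scheme.HasResolution (Spec (CommRingCat.of ↥TA[r, a])) :=
  ⟨fun z => Theorems.FRationalResolution.toricSurface_stalk_clause k p r a (by omega) z,
    Theorems.FRationalResolution.hasResolution_toricSurface k r a har⟩

end Toric

/-! ## CONE PROGRAMME (lead c5): rung 4′ in ALL DIMENSIONS on the Veronese cones, every field

Objects (no new definitions — terms under local notation, as in the toric programme):
* `MP[n] = MvPolynomial (Fin n) k`;
* `VR[n, r] = k[χᵈ : |d| = r] ⊆ MP[n]` — the `r`-th VERONESE SUBRING, coordinate ring of the affine cone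
  `V(n,r)` over the `r`-th Veronese embedding of `ℙⁿ⁻¹`, equivalently the ring of invariants
  `k[x₁,…,xₙ]^{μ_r}` of the diagonal action with weights `(1,…,1)` — a diagonalizable quotient singularity in
  the sense of X₂ (`A = ℤ/r`, `S = k[x₁,…,xₙ]` graded by total degree mod `r`, chart = iso), for EVERY field
  and every `r` including the wild case `p ∣ r`; an ISOLATED singularity of dimension `n` (singular for
  `n, r ≥ 2`), Gorenstein iff `r ∣ n`, a direct summand of `k[x₁,…,xₙ]` (so every ideal of every local
  ring is tightly closed: it lies in the class of rung 4′, a fortiori of the crux);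
* `VM[n, r] ⊆ VR[n, r]` — the VERTEX IDEAL, spanned by the degree-`r` monomials.

THE STEP (one blow-up, every dimension): `π : Bl_{VM} V(n,r) → V(n,r)` is proper and birational
(`affineBlowup.isResolution`); its chart at the pure power `xᵢʳ` is the affine `n`-space
`Spec k[xᵢʳ, xⱼ/xᵢ (j ≠ i)]` (`stub_veronese_chart_isRegularRing`), and these `n` charts COVER the blow-up
(`stub_affineBlowup_cover_of_pow`, a generic sub-cover criterion, fed by `stub_veronese_pow`:
`(χᵈ)ʳ = xᵢʳ · χ^{r(d − eᵢ)}` with `χ^{r(d−eᵢ)} ∈ VM^{r−1}` by splitting exponent vectors,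
`stub_finsupp_degree_split`). Hence `hasResolution_veroneseCone`: rung 4′ holds on `V(n,r)` for ALL
`n, r ≥ 1` — the first ISOLATED singular members of the class of dimension `≥ 3` resolved in the tree
(dimension `≥ 4` included, where nothing conditional on `CossartPiltant2019` is available).
-/

section Cones

variable (k : Type) [Field k]

/-- The polynomial ring in `n` variables. -/
local notation3 "MP[" n "]" => MvPolynomial (Fin n) k

/-- The `r`-th Veronese subring of `k[x₁,…,xₙ]`: the `k`-subalgebra generated by the degree-`r` monomials. -/
local notation3 "VR[" n ", " r "]" =>
  Algebra.adjoin k ((fun d : Fin n →₀ ℕ => MvPolynomial.monomial d (1 : k)) ''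
    {d : Fin n →₀ ℕ | Finsupp.degree d = (r : ℕ)})

/-- The vertex ideal of the Veronese cone: spanned by the degree-`r` monomials. -/
local notation3 "VM[" n ", " r "]" =>
  Ideal.span {v : ↥VR[n, r] | ∃ d : Fin n →₀ ℕ, Finsupp.degree d = (r : ℕ) ∧
    (v : MvPolynomial (Fin n) k) = MvPolynomial.monomial d 1}

/-! ### Worker stubs (wave 1) -/

/-- STUB (splitting exponent vectors; pure combinatorics): an exponent vector of total degree `r·s` is a
sum of `s` exponent vectors of total degree `r` (induction on `s`: peel off any `e ≤ d` with `|e| = r`,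
which exists greedily since `|d| ≥ r`). [folklore] -/
theorem stub_finsupp_degree_split {n : ℕ} (r s : ℕ) (d : Fin n →₀ ℕ) (hd : Finsupp.degree d = r * s) :
    ∃ e : Fin s → (Fin n →₀ ℕ), (∀ j, Finsupp.degree (e j) = r) ∧ d = ∑ j, e j := by
  sorry

/-- STUB (membership in the Veronese subring): for `1 ≤ r`, a polynomial lies in `VR[n,r]` iff every
monomial in its support has total degree divisible by `r`. (`→`: `Algebra.adjoin_induction`, degrees add on
products of monomials; `←`: a monomial of degree `r·s` is a product of `s` degree-`r` monomials by the
splitting hypothesis, and `f` is the `k`-combination of its monomials.) [folklore; BrunsHerzog1998 §6.1 / Goto–Watanabe 1978 §3] -/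
theorem stub_veronese_mem_iff (n r : ℕ) (hr : 1 ≤ r)
    (hsplit : ∀ (s : ℕ) (d : Fin n →₀ ℕ), Finsupp.degree d = r * s →
      ∃ e : Fin s → (Fin n →₀ ℕ), (∀ j, Finsupp.degree (e j) = r) ∧ d = ∑ j, e j)
    (f : MP[n]) : f ∈ VR[n, r] ↔ ∀ d ∈ f.support, r ∣ Finsupp.degree d := by
  sorry

/-- STUB (`VR[n,r]` is a DIRECT SUMMAND of `k[x₁,…,xₙ]`; the Reynolds operator of `μ_r` written on degrees,
valid also for `p ∣ r`): given the membership criterion, the projection `ρ` onto the `k`-span of the monomials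
of degree `≡ 0 (mod r)` (the weight-`0` component for the weight `Fin n → ZMod r, _ ↦ 1`,
`MvPolynomial.weightedHomogeneousComponent`) is additive, lands in `VR[n,r]`, fixes it, and is `VR[n,r]`-linear
(coefficientwise: in `coeff_mul` only pairs with first factor of degree `≡ 0` contribute). [folklore; BrunsHerzog1998 §6.1, HochsterHuneke1990 Prop. 4.12 context] -/
theorem stub_veronese_retract (n r : ℕ) (hr : 1 ≤ r)
    (hmem : ∀ f : MP[n], f ∈ VR[n, r] ↔ ∀ d ∈ f.support, r ∣ Finsupp.degree d) :
    ∃ ρ : MP[n] →+ ↥VR[n, r], (∀ t : ↥VR[n, r], ρ (t : MP[n]) = t) ∧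
      ∀ (t : ↥VR[n, r]) (g : MP[n]), ρ ((t : MP[n]) * g) = t * ρ g := by
  sorry

/-- STUB (the chart of `Bl_{VM} V(n,r)` at the pure power `xᵢʳ` is an affine `n`-space): for `1 ≤ r` the affine
blow-up algebra `VR[n,r][VM/xᵢʳ] ⊆ VR[n,r][1/xᵢʳ]` is a regular ring — it is `k[xᵢʳ, xⱼ/xᵢ (j ≠ i)]`, a polynomial
ring in `n` variables: the `k`-algebra map `MP[n] → VR[n,r][1/xᵢʳ]`, `X i ↦ xᵢʳ/1`,
`X j ↦ (xⱼxᵢʳ⁻¹/1)·(xᵢʳ/1)⁻¹` is injective (compare exponents after composing into a Laurent/fraction ring: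
`e ↦ (r eᵢ − Σ_{j≠i} eⱼ ; eⱼ)` is injective) with range the blow-up algebra (`⊇`: each `χᵈ/xᵢʳ`, `|d| = r`, is
`Π_{j≠i} (xⱼ/xᵢ)^{dⱼ}` and each generator `χᵈ = xᵢʳ Π_{j≠i}(xⱼ/xᵢ)^{dⱼ}`; `⊆`: `xⱼ/xᵢ = (xⱼxᵢʳ⁻¹)/xᵢʳ`);
transport `IsRegularRing (MvPolynomial (Fin n) k)`. Template: …ToricXChartRegular.lean (p165031).
[folklore; Kollar2007 §2.2 (blowing up the vertex of a cone)] -/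
theorem stub_veronese_chart_isRegularRing (n r : ℕ) (hr : 1 ≤ r) (i : Fin n) (xi : ↥VR[n, r])
    (hxi : (xi : MP[n]) = MvPolynomial.X i ^ r) :
    IsRegularRing ↥(blowupAlgebra VM[n, r] xi) := by
  sorry

/-- STUB (generic SUB-COVER of a blow-up by the charts of a reduction; abstract `R`): if `I = (S)` and every
generator `s ∈ S` has a power of the form `s^(N+1) = gᵢ · q` with `q ∈ I^N` for one of finitely or infinitely
many fixed elements `gᵢ ∈ I`, then the charts `D₊(gᵢ t)` cover `Bl_I Spec R = Proj R[It]`: for a relevant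
homogeneous prime `𝔭` containing every `gᵢ t`, `(s t)^(N+1) = (gᵢ t)(q tᴺ) ∈ 𝔭` gives `s t ∈ 𝔭` for all
`s ∈ S`, hence `b t ∈ 𝔭` for all `b ∈ I` and `R[It]₊ ⊆ 𝔭` (`irrelevant_le_span_reesT`), absurd. [folklore;
cf. StacksProject Tag 0804, HunekeSwanson2006 §8.1 (reductions)] -/
theorem stub_affineBlowup_cover_of_pow {R : Type} [CommRing R] (S : Set R) {ι : Type} (g : ι → R)
    (hg : ∀ i, g i ∈ Ideal.span S)
    (hpow : ∀ s ∈ S, ∃ i, ∃ N : ℕ, ∃ q ∈ Ideal.span S ^ N, s ^ (N + 1) = g i * q)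
    (p : affineBlowup (Ideal.span S)) :
    ∃ i, p ∈ Proj.basicOpen (reesGrading (Ideal.span S)) (reesT (g i) (hg i)) := by
  sorry

/-- STUB (the monomial identity feeding the sub-cover): for a degree-`r` monomial `s = χᵈ ∈ VR[n,r]` pick `i`
with `dᵢ ≥ 1`; then `sʳ = xᵢʳ · χ^{r(d − eᵢ)}` and `χ^{r(d−eᵢ)}`, of degree `r(r−1)`, is a product of `r − 1`
degree-`r` monomials (splitting hypothesis), so lies in `VM^(r−1)`. [folklore] -/
theorem stub_veronese_pow (n r : ℕ) (hr : 1 ≤ r)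
    (hsplit : ∀ (s : ℕ) (d : Fin n →₀ ℕ), Finsupp.degree d = r * s →
      ∃ e : Fin s → (Fin n →₀ ℕ), (∀ j, Finsupp.degree (e j) = r) ∧ d = ∑ j, e j)
    (g : Fin n → ↥VR[n, r]) (hg : ∀ i, ((g i : ↥VR[n, r]) : MP[n]) = MvPolynomial.X i ^ r)
    (s : ↥VR[n, r]) (d : Fin n →₀ ℕ) (hd : Finsupp.degree d = r)
    (hs : (s : MP[n]) = MvPolynomial.monomial d 1) :
    ∃ i, ∃ N : ℕ, ∃ q ∈ VM[n, r] ^ N, s ^ (N + 1) = g i * q := by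
  sorry

/-- STUB (`V(n,r)` has dimension `n`): `k[x₁,…,xₙ]` is integral over `VR[n,r]` (`xⱼʳ ∈ VR[n,r]`), so
`dim VR[n,r] = dim k[x₁,…,xₙ] = n` (tree: `ringKrullDim_eq_of_isIntegral` for the injective integral inclusion;
Mathlib: `MvPolynomial.ringKrullDim`). [folklore] -/
theorem stub_veronese_ringKrullDim (n r : ℕ) (hr : 1 ≤ r) : ringKrullDim ↥VR[n, r] = n := by
  sorry

/-! ### Lead: the generic one-blow-up resolution and the assembly -/

/-- **One blow-up resolutions (generic).** If `R` is a Noetherian domain, `0 ≠ I ⊆ R`, and a family of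
elements `gᵢ ∈ I` has regular affine blow-up algebras `R[I/gᵢ]` whose charts `D₊(gᵢ t)` cover `Bl_I Spec R`,
then `Spec R` has a resolution of singularities (`Bl_I Spec R → Spec R`, `affineBlowup.isResolution`,
`reesChartEquiv`). [folklore; StacksProject Tag 02OS, 0804] -/
theorem hasResolution_of_regular_charts {R : Type} [CommRing R] [IsDomain R] [IsNoetherianRing R]
    (I : Ideal R) (hI : I ≠ ⊥) {ι : Type} (g : ι → R) (hg : ∀ i, g i ∈ I)
    (hcov : ∀ p : affineBlowup I, ∃ i, p ∈ Proj.basicOpen (reesGrading I) (reesT (g i) (hg i)))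
    (hreg : ∀ i, IsRegularRing ↥(blowupAlgebra I (g i))) :
    Scheme.HasResolution (Spec (CommRingCat.of R)) := by
  have hregB : Scheme.IsRegular (affineBlowup I) := by
    refine Scheme.IsRegular.of_forall_exists_isOpenImmersion fun p => ?_
    obtain ⟨i, hi⟩ := hcov p
    haveI := hreg i
    haveI : IsRegularRing (CommRingCat.of (HomogeneousLocalization.Away (reesGrading I)
        (reesT (g i) (hg i)))) :=
      IsRegularRing.of_ringEquiv (reesChartEquiv (g i) (hg i)).symm
    refine ⟨_, Proj.awayι (reesGrading I) (reesT (g i) (hg i)) (reesT_mem (g i) (hg i)) Nat.one_pos,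
      inferInstance, ?_, Scheme.isRegular_Spec _⟩
    rw [← Scheme.Hom.coe_opensRange, Proj.opensRange_awayι]
    exact hi
  exact ⟨_, affineBlowup.π I, affineBlowup.isResolution hI hregB⟩

/-- `VR[n,r]` is of finite type over `k` (finitely many degree-`r` exponent vectors:
`Finset.finsuppAntidiag`). [folklore] -/
theorem veronese_finiteType (n r : ℕ) : Algebra.FiniteType k ↥VR[n, r] := by
  classical
  rw [← Subalgebra.fg_iff_finiteType]
  refine ⟨(Finset.univ.finsuppAntidiag r).image (fun d : Fin n →₀ ℕ => MvPolynomial.monomial d (1 : k)), ?_⟩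
  rw [Finset.coe_image]
  congr 1
  ext f
  simp only [Set.mem_image, Finset.mem_coe, Finset.mem_finsuppAntidiag, Finset.subset_univ, and_true,
    Set.mem_setOf_eq, Finsupp.degree_eq_sum]

/-- **RUNG 4′ ON THE VERONESE CONES, EVERY DIMENSION, EVERY FIELD.** For all `n, r ≥ 1` and every field `k`,
the affine cone `V(n,r) = Spec k[χᵈ : |d| = r]` over the `r`-th Veronese embedding of `ℙⁿ⁻¹` — the cyclic
quotient singularity `𝔸ⁿ/μ_r` of type `1/r(1,…,1)`, wild case `p ∣ r` included — HAS A RESOLUTION OF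
SINGULARITIES: one blow-up of the vertex, whose `n` charts at `x₁ʳ, …, xₙʳ` are affine `n`-spaces and cover.
[folklore; Kollar2007 §2.2] -/
theorem hasResolution_veroneseCone (n r : ℕ) (hn : 1 ≤ n) (hr : 1 ≤ r) :
    Scheme.HasResolution (Spec (CommRingCat.of ↥VR[n, r])) := by
  haveI : Algebra.FiniteType k ↥VR[n, r] := veronese_finiteType k n r
  haveI : IsNoetherianRing ↥VR[n, r] := Algebra.FiniteType.isNoetherianRing k _
  haveI : IsDomain ↥VR[n, r] := inferInstance
  -- the pure powers `xᵢʳ ∈ VM`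
  have hxmem : ∀ i : Fin n, (MvPolynomial.X i ^ r : MP[n]) ∈ VR[n, r] := fun i =>
    Algebra.subset_adjoin ⟨Finsupp.single i r, by simp [Finsupp.degree_single],
      by simp [MvPolynomial.X_pow_eq_monomial]⟩
  let g : Fin n → ↥VR[n, r] := fun i => ⟨_, hxmem i⟩
  have hgval : ∀ i, ((g i : ↥VR[n, r]) : MP[n]) = MvPolynomial.X i ^ r := fun i => rfl
  have hg : ∀ i, g i ∈ VM[n, r] := fun i =>
    Ideal.subset_span ⟨Finsupp.single i r, by simp [Finsupp.degree_single],
      by simp [hgval, MvPolynomial.X_pow_eq_monomial]⟩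
  have hI : VM[n, r] ≠ ⊥ := by
    intro h0
    have h1 : g ⟨0, hn⟩ = 0 := by simpa [h0] using hg ⟨0, hn⟩
    have h2 := congrArg (fun v : ↥VR[n, r] => (v : MP[n])) h1
    simp only [hgval, ZeroMemClass.coe_zero] at h2
    exact (pow_ne_zero r (MvPolynomial.X_ne_zero (R := k) (⟨0, hn⟩ : Fin n))) h2
  refine hasResolution_of_regular_charts _ hI g hg (fun p => ?_) (fun i => ?_)
  · refine stub_affineBlowup_cover_of_pow _ g hg ?_ p
    rintro s ⟨d, hd, hs⟩
    exact stub_veronese_pow k n r hr (fun s d hd => stub_finsupp_degree_split r s d hd) g hgval s d hd hs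
  · exact stub_veronese_chart_isRegularRing k n r hr i (g i) (hgval i)

end Cones

/-! ## The crux BY NAME -/

/-- Composition onto the crux: `FRationalResolution ⇐ X₁ ∧ X₂` is the `⇐` direction of the landed
equivalence `fRationalResolution_iff_rungs` (p129251). -/
theorem FRationalResolution_of :
    Summit.ResolutionOfSingularities.ResolutionOfSingularities.Theses.FrobeniusLadder.FRationalResolution :=
  Theorems.FRationalResolution.fRationalResolution_iff_rungs.mpr
    ⟨WeaklyFRegularModification_of, WeaklyFRegularResolution_of⟩

end Summit.ResolutionOfSingularities.ResolutionOfSingularities.Cruxes.FRationalResolution.Redirect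

end
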